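import Summits.NavierStokesRegularity.NavierStokesRegularity.Theses.AxisymmetricExtremality
import Literature.Analysis.FluidPDE.RusinSverakCompactness
import Literature.Analysis.FluidPDE.SolenoidalL2Duality

/-!
# Route AxisymmetricExtremality — crux `MinimalDatumPFold` (stmt-NavierStokesRegularity-15452), stub `stub_minimalDatum_not_aeZero`

Registered stub of the line `registered` (`Cruxes/MinimalDatumPFold/Lines/birth.lean`, lead c1 reshape).
Target tree file: `Summits/NavierStokesRegularity/NavierStokesRegularity/Theorems/AxisymmetricExtremalityMinimalDatumPFoldNotAeZero.lean`.

A Rusin–Šverák minimal blow-up datum `u₀` (`IsMinimalBlowupDatum ν u₀ g`) is not a.e. zero: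
if `u₀ =ᵐ 0`, the time-constant field `u t := u₀` is a global Kato solution with datum `u₀`
(every pairing `∫ ⟪u₀, ψ⟫` vanishes, so the duality identity reads `0 = 0 + 0 + 0`; the slices
are weakly divergence free and lie in `L³` by hypothesis; `‖u t - u t₀‖₃ = ‖0‖₃ = 0`; and
`uncurry u = u₀ ∘ Prod.snd` is a.e. strongly measurable), contradicting
`¬ HasGlobalKatoSolution ν u₀`.
-/

set_option linter.dupNamespace false

noncomputable section

open MeasureTheory Set Function Filter Topology
open scoped ENNReal NNReal

namespace Summit.NavierStokesRegularity.NavierStokesRegularity.Theorems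

/-- **A minimal blow-up datum is not a.e. zero.** If `u₀` is a Rusin–Šverák `Ḣ^{1/2}`-minimal
blow-up datum for viscosity `ν` (`IsMinimalBlowupDatum ν u₀ g`: `u₀ ∈ L³` weakly divergence free,
represented by `g` with `‖g‖ = ρ_max^pure(ν)`, and without a global Kato solution), then `u₀` is
not a.e. equal to the zero field. Proof: were `u₀ =ᵐ 0`, the time-constant field `u t := u₀`
would be a global Kato solution with datum `u₀` — all pairings `∫ ⟪u₀, ψ⟫` vanish, so the duality
identity is `0 = 0 + 0 + 0`; weak divergence-freeness and `L³`-membership of the slices are the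
hypotheses; `L³`-continuity is trivial (`u t - u t₀ = 0`); and `uncurry u = u₀ ∘ Prod.snd` is
a.e. strongly measurable — contradicting the last clause of minimality. [folklore] -/
theorem stub_minimalDatum_not_aeZero :
    ∀ (ν : ℝ) (u₀ : EuclideanSpace ℝ (Fin 3) → EuclideanSpace ℝ (Fin 3)) (g : Literature.Analysis.FunctionSpaces.HomSobolev (EuclideanSpace ℝ (Fin 3)) (EuclideanSpace ℂ (Fin 3)) (1 / 2 : ℝ)), Literature.Analysis.FluidPDE.IsMinimalBlowupDatum ν u₀ g → ¬ (u₀ =ᵐ[(MeasureTheory.volume : MeasureTheory.Measure (EuclideanSpace ℝ (Fin 3)))] (0 : EuclideanSpace ℝ (Fin 3) → EuclideanSpace ℝ (Fin 3))) := by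
  intro ν u₀ g h hae
  obtain ⟨hL3, _hrep, hdiv, _hnorm, hblow⟩ := h
  apply hblow
  -- every pairing of `u₀` against any field vanishes
  have hpair : ∀ ψ : EuclideanSpace ℝ (Fin 3) → EuclideanSpace ℝ (Fin 3),
      ∫ x, (inner ℝ (u₀ x) (ψ x) : ℝ) = 0 := fun ψ => by
    have hzero : (fun x => (inner ℝ (u₀ x) (ψ x) : ℝ)) =ᵐ[volume] fun _ => (0 : ℝ) := by
      filter_upwards [hae] with x hx
      rw [hx, Pi.zero_apply, inner_zero_left]
    rw [integral_congr_ae hzero, integral_zero]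
  refine ⟨fun _ => u₀, ⟨fun _ _ => hdiv, fun t _ => ?_⟩, ⟨fun _ _ => hL3, fun t₀ _ => ?_⟩, rfl, ?_⟩
  · -- the duality identity: every term vanishes
    intro φ _ _
    simp only [hpair, Pi.zero_apply, inner_zero_left, integral_zero,
      intervalIntegral.integral_zero, add_zero]
  · -- `L³`-continuity in time of a time-constant field
    simp only [sub_self, eLpNorm_zero]
    exact tendsto_const_nhds
  · -- measurability on `(0, ∞) × ℝ³`
    exact (hL3.aestronglyMeasurable.comp_snd (μ := (volume : Measure ℝ))).restrict

end Summit.NavierStokesRegularity.NavierStokesRegularity.Theorems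

end
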